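import Literature.Analysis.FluidPDE.PassiveVectorVarTensorLionsGraph
import Literature.Analysis.FluidPDE.PassiveVectorVarTensorL2WeakBound
import Literature.Analysis.FluidPDE.PassiveVectorVarTensor
import Literature.Analysis.FluidPDE.PassiveVectorTensorLionsExistence
import HarnessLib

/-!
# Existence of `L²ₜH¹ₓ` weak solutions of the VARIABLE-tensor passive-vector equation (J.-L. Lions)

Analysis/FluidPDE file (everything proved; no definitions, no named facts). **Existence in the class
`Torus.IsWeakVarTensorPassiveVectorOn 0 T 𝔹 b w₀ w`** (`PassiveVectorVarTensor`) of the variable-coefficient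
anisotropic-viscosity passive-vector equation `∂ₜw + (b·∇)w + ∇π = ∇·(𝔹(t,y)∇w)`, `∇·w = 0`, `w(0) = w₀`
on `T^d × (0,T)`, for `T > 0`, a coefficient field `𝔹` with smooth slices, `𝔹` and `∂_y𝔹` jointly
continuous, entrywise `δ`-close (`δ ≥ 0`) to a constant tensor `𝔸` with Legendre–Hadamard constants
`NearIso 𝔸 lo hi` and STRICT ellipticity `(card d)²δ < lo`, an essentially bounded carrier weakly
divergence free for a.e. `t`, and a weakly divergence-free datum `w₀ ∈ L²` — TOGETHER WITH the
`L²(0,T; H¹(T^d))` regularity of the constructed solution (an honest weak space gradient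
`G t c = ∂_c w(t)` in `L²(μ_T)`, `Torus.HasWeakPartialDeriv`) and the `L^∞_t L²_x` energy bound
`∫‖w(t)‖² ≤ ‖w₀‖² + (4d²M²/lo)‖w‖²_{L²(μ_T)} + (d⁴δ²/lo) Σ_c‖G c‖²_{L²(μ_T)}` for a.e. `t`
(`exists_isWeakVarTensorPassiveVectorOn`).

Architecture (Lions–Magenes 1972, Chap. 3, Thm. 1.1 with the `V = H¹_σ`-coercive form of §4.4, as in
Temam 1984, Ch. III §1 Thm. 1.1): the damped solution is produced by Lions' projection theorem in the GRAPH
space `L²(μ_T; (ψ, ∇ψ))` (`PassiveVectorVarTensorLionsGraph.exists_dampedWeakVar_graph`, coercive by the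
perturbative Gårding inequality with its gradient term); its derivative components are the weak space
gradient of its value and its value slices are weakly divergence free
(`PassiveVectorVarTensorLionsGradient`); `w = eᵗ v` solves the undamped weak formulation
(`undamped_weak_of_dampedVar`); the truncated energy argument, with the variable tensor split into the
constant Gårding part and a perturbation moved onto the weak gradient, gives `w ∈ L^∞_t L²_x`
(`PassiveVectorVarTensorL2WeakBound.ae_integral_norm_sq_le_of_weakVar`); the remaining fields are
bookkeeping (as in `PassiveVectorTensorLionsExistence`). Consumer: cell `ad-ideate`, K1L_D
(`stmt-AnomalousDissipation-27980`), the distorted cell problem of the Lagrangian renormalisation step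
(lead memo L9 §5, Z7α).

## References

* J.-L. Lions, E. Magenes, *Non-homogeneous boundary value problems and applications* I (1972), Chap. 3,
  Thm. 1.1, §4.3–§4.4. [`LionsMagenes1972`]
* R. Temam, *Navier–Stokes Equations*, 3rd ed. (1984), Ch. III §1, Thm. 1.1. [`Temam1984`]
* M. Giaquinta, *Multiple integrals in the calculus of variations* (Princeton 1983), Ch. III §2. [`Giaquinta1983MultipleIntegrals`]
* J. C. Robinson, J. L. Rodrigo, W. Sadowski, *The three-dimensional Navier–Stokes equations* (CUP 2016), §4.2. [`RobinsonRodrigoSadowski2016`]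
-/

noncomputable section

open MeasureTheory Set Filter Function TopologicalSpace
open scoped ENNReal NNReal InnerProductSpace Topology

namespace Literature.Analysis.FluidPDE

namespace Torus

variable {d : Type*} [Fintype d]

section Prelim

/-- Almost every point of `(vol|(0,T)) ⊗ vol` has its time coordinate in `(0,T)`. [folklore] -/
private theorem ae_fst_mem_Ioo_V6 (T : ℝ) :
    ∀ᵐ p : ℝ × UnitAddTorus d ∂(((volume : Measure ℝ).restrict (Ioo 0 T)).prod volume), p.1 ∈ Ioo 0 T :=
  (Measure.quasiMeasurePreserving_fst (μ := (volume : Measure ℝ).restrict (Ioo 0 T))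
    (ν := (volume : Measure (UnitAddTorus d)))).ae (ae_restrict_mem measurableSet_Ioo)

/-- Constant multiples of weakly divergence-free fields are weakly divergence free. [folklore] -/
private theorem isWeaklyDivFree_const_smul_V6 {u : UnitAddTorus d → EuclideanSpace ℝ d}
    (hu : FunctionSpaces.Torus.IsWeaklyDivFree u) (c : ℝ) :
    FunctionSpaces.Torus.IsWeaklyDivFree (fun x => c • u x) := by
  intro θ hθ
  simp only [real_inner_smul_left, integral_const_mul, hu θ hθ, mul_zero]

/-- Constant multiples preserve weak partial derivatives. [folklore] -/
private theorem hasWeakPartialDeriv_const_smul_V6 [DecidableEq d] {i : d} {f g : UnitAddTorus d → EuclideanSpace ℝ d}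
    (h : FunctionSpaces.Torus.HasWeakPartialDeriv i f g) (a : ℝ) :
    FunctionSpaces.Torus.HasWeakPartialDeriv i (fun x => a • f x) (fun x => a • g x) := by
  intro φ hφ
  have h1 := h φ hφ
  simp_rw [smul_comm _ a, integral_smul, h1, smul_neg]

/-- Pairings of two `L²` fields are integrable. [folklore] -/
private theorem integrable_inner_of_memLp_two_V6 {X : Type*} [MeasurableSpace X] {μ : Measure X}
    {a g : X → EuclideanSpace ℝ d} (ha : MemLp a 2 μ) (hg : MemLp g 2 μ) :
    Integrable (fun x => ⟪a x, g x⟫_ℝ) μ :=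
  (ha.norm.integrable_mul hg.norm).mono' (ha.aestronglyMeasurable.inner hg.aestronglyMeasurable)
    (ae_of_all _ fun x => norm_inner_le_norm (a x) (g x))

end Prelim

section Existence

variable [DecidableEq d]

/-- **Existence of `L²ₜH¹ₓ` weak solutions of the VARIABLE-tensor passive-vector equation** (J.-L. Lions'
theorem in the graph space): for `T > 0`, `NearIso 𝔸 lo hi`, a coefficient field `𝔹` (smooth slices; `𝔹`,
`∂_y𝔹` jointly continuous) with `|𝔹 − 𝔸| ≤ δ` entrywise, `0 ≤ δ`, `(card d)²δ < lo`, a carrier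
`b ∈ L^∞((0,T) × T^d)` (space–time lift) weakly divergence free for a.e. `t`, and a weakly
divergence-free datum `w₀ ∈ L²(T^d)`, there are a weak solution `w` in the class
`IsWeakVarTensorPassiveVectorOn 0 T 𝔹 b w₀` AND a weak space gradient `G` of it:
`(t,x) ↦ G t c x ∈ L²(μ_T)` and `Torus.HasWeakPartialDeriv c (w t) (G t c)` for a.e. `t` and every `c`
(`w ∈ L²(0,T; H¹)`), with the `L^∞_t L²_x` energy bound
`∫‖w(t)‖² ≤ ‖w₀‖² + (4(dM)²/lo)‖w‖²_{L²(μ_T)} + ((d²δ)²/lo) Σ_c ‖G c‖²_{L²(μ_T)}` for a.e. `t`, for every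
essential bound `M ≥ 0` of the carrier (Lions–Magenes 1972, Chap. 3, Thm. 1.1, with the `V`-coercive form
of §4.4; Temam 1984, Ch. III §1, Thm. 1.1). [cite: LionsMagenes1972, Chap. 3 Thm. 1.1] -/
theorem exists_isWeakVarTensorPassiveVectorOn {T : ℝ} (hT : 0 < T) {𝔸 : Visc4 d} {lo hi : ℝ}
    (h𝔸 : NearIso 𝔸 lo hi) {𝔹 : ℝ → UnitAddTorus d → Visc4 d}
    (h𝔹s : ∀ t i c j e, FunctionSpaces.Torus.IsSmooth (fun y => 𝔹 t y i c j e))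
    (h𝔹c : ∀ i c j e, Continuous (uncurry fun t y => 𝔹 t y i c j e))
    (h𝔹d : ∀ i c j e e', Continuous (uncurry fun t y =>
      FunctionSpaces.Torus.partialDeriv e' (fun y => 𝔹 t y i c j e) y))
    {δ : ℝ} (hδ0 : 0 ≤ δ) (hδ : ∀ t y i c j e, |𝔹 t y i c j e - 𝔸 i c j e| ≤ δ)
    (hlo : (Fintype.card d : ℝ) ^ 2 * δ < lo)
    {b : ℝ → UnitAddTorus d → EuclideanSpace ℝ d}
    (hb : MemLp (FunctionSpaces.Torus.stLift b) ∞ (volume.restrict (Ioo 0 T ×ˢ univ)))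
    (hbdiv : ∀ᵐ t ∂(volume.restrict (Ioo 0 T)), FunctionSpaces.Torus.IsWeaklyDivFree (b t))
    {M : ℝ} (hM : 0 ≤ M)
    (hbM : ∀ᵐ p ∂(((volume : Measure ℝ).restrict (Ioo 0 T)).prod (volume : Measure (UnitAddTorus d))),
      ‖uncurry b p‖ ≤ M)
    {w₀ : UnitAddTorus d → EuclideanSpace ℝ d} (hw₀ : MemLp w₀ 2 volume)
    (hdiv₀ : FunctionSpaces.Torus.IsWeaklyDivFree w₀) :
    ∃ (w : ℝ → UnitAddTorus d → EuclideanSpace ℝ d) (G : ℝ → d → UnitAddTorus d → EuclideanSpace ℝ d),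
      IsWeakVarTensorPassiveVectorOn 0 T 𝔹 b w₀ w ∧
      MemLp (uncurry w) 2 (((volume : Measure ℝ).restrict (Ioo 0 T)).prod volume) ∧
      (∀ c, MemLp (uncurry (G · c)) 2 (((volume : Measure ℝ).restrict (Ioo 0 T)).prod volume)) ∧
      (∀ᵐ t ∂(volume.restrict (Ioo 0 T)), MemLp (w t) 2 volume ∧
        ∀ c, MemLp (G t c) 2 volume ∧ FunctionSpaces.Torus.HasWeakPartialDeriv c (w t) (G t c)) ∧
      (∀ᵐ t ∂(volume.restrict (Ioo 0 T)),
        ∫ x, ‖w t x‖ ^ 2 ≤ (∫ x, ‖w₀ x‖ ^ 2) +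
          2 * (2 * (Fintype.card d * M) ^ 2 / lo) *
            ∫ p, ‖uncurry w p‖ ^ 2 ∂(((volume : Measure ℝ).restrict (Ioo 0 T)).prod volume) +
          2 * (((Fintype.card d : ℝ) ^ 2 * δ) ^ 2 / (2 * lo)) *
            ∑ c, ∫ p, ‖uncurry (G · c) p‖ ^ 2 ∂(((volume : Measure ℝ).restrict (Ioo 0 T)).prod volume)) := by
  set μ : Measure (ℝ × UnitAddTorus d) := ((volume : Measure ℝ).restrict (Ioo 0 T)).prod volume with hμ
  have hlo0 : 0 < lo := lt_of_le_of_lt (by positivity) hlo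
  -- the carrier read on `(0,T) × T^d`
  have hbm : AEStronglyMeasurable (uncurry b) μ := by
    have h := FunctionSpaces.Torus.aestronglyMeasurable_uncurry_of_stLift_restrict hb.aestronglyMeasurable
    rwa [Measure.volume_eq_prod, ← Measure.prod_restrict, Measure.restrict_univ] at h
  have hbMt : ∀ᵐ t ∂(volume.restrict (Ioo 0 T)), ∀ᵐ x ∂volume, ‖b t x‖ ≤ M :=
    Measure.ae_ae_of_ae_prod hbM
  -- J.-L. Lions in the graph space
  obtain ⟨U, hUF, hUweak⟩ := exists_dampedWeakVar_graph hT h𝔸 h𝔹s h𝔹c h𝔹d hδ hlo hbm hbM hbdiv hw₀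
  set Uf : ℝ × UnitAddTorus d → PiLp 2 (fun _ : Option d => EuclideanSpace ℝ d) :=
    (U : ℝ × UnitAddTorus d → PiLp 2 (fun _ : Option d => EuclideanSpace ℝ d)) with hUf
  have hUm : MemLp Uf 2 μ := Lp.memLp U
  set V : ℝ × UnitAddTorus d → EuclideanSpace ℝ d := fun p => Uf p none with hV
  have hVm : MemLp V 2 μ := hUm.eval_piLp none
  have hVcm : ∀ c, MemLp (fun p => Uf p (some c)) 2 μ := fun c => hUm.eval_piLp (some c)
  -- the undamped field `w = eᵗ v` and its weak gradient
  set w : ℝ → UnitAddTorus d → EuclideanSpace ℝ d := fun t x => Real.exp t • V (t, x) with hw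
  set G : ℝ → d → UnitAddTorus d → EuclideanSpace ℝ d := fun t c x => Real.exp t • Uf (t, x) (some c) with hG
  have hslice := ae_isWeaklyDivFree_of_mem_closure_graph hUF
  have hgrad := ae_hasWeakPartialDeriv_of_mem_closure_graph hUF
  have hw2s : ∀ᵐ t ∂(volume.restrict (Ioo 0 T)), MemLp (w t) 2 volume := by
    filter_upwards [hslice] with t ht
    exact ht.1.const_smul (Real.exp t)
  have hdivw : ∀ᵐ t ∂(volume.restrict (Ioo 0 T)), FunctionSpaces.Torus.IsWeaklyDivFree (w t) := by
    filter_upwards [hslice] with t ht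
    exact isWeaklyDivFree_const_smul_V6 ht.2 (Real.exp t)
  have hGw : ∀ᵐ t ∂(volume.restrict (Ioo 0 T)), ∀ c,
      MemLp (G t c) 2 volume ∧ FunctionSpaces.Torus.HasWeakPartialDeriv c (w t) (G t c) := by
    filter_upwards [hgrad] with t ht
    intro c
    exact ⟨(ht.1.eval_piLp (some c)).const_smul (Real.exp t), hasWeakPartialDeriv_const_smul_V6 (ht.2 c) (Real.exp t)⟩
  have hexp_le : ∀ {f : ℝ × UnitAddTorus d → EuclideanSpace ℝ d},
      MemLp f 2 μ → MemLp (fun p : ℝ × UnitAddTorus d => Real.exp p.1 • f p) 2 μ := by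
    intro f hf
    refine MemLp.of_le_mul (c := Real.exp T) hf
      ((Real.continuous_exp.comp continuous_fst).aestronglyMeasurable.smul hf.aestronglyMeasurable) ?_
    filter_upwards [ae_fst_mem_Ioo_V6 (d := d) T] with p hp
    rw [norm_smul, Real.norm_eq_abs, abs_of_pos (Real.exp_pos _)]
    exact mul_le_mul_of_nonneg_right (Real.exp_le_exp.2 hp.2.le) (norm_nonneg _)
  have hwm : AEStronglyMeasurable (uncurry w) μ :=
    (Real.continuous_exp.comp continuous_fst).aestronglyMeasurable.smul hVm.aestronglyMeasurable
  have hw2 : MemLp (uncurry w) 2 μ := by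
    have h := hexp_le hVm
    exact h
  have hG2 : ∀ c, MemLp (uncurry (G · c)) 2 μ := fun c => hexp_le (hVcm c)
  have hw1 : Integrable (uncurry w) μ := hw2.integrable one_le_two
  -- the undamped weak formulation
  have hweak : ∀ Ψ : ℝ → UnitAddTorus d → EuclideanSpace ℝ d, FunctionSpaces.Torus.IsSpaceTimeTest T Ψ →
      (∀ t, FunctionSpaces.Torus.IsDivFree (Ψ t)) →
      (∫ p, ⟪w p.1 p.2, FunctionSpaces.Torus.timeDeriv Ψ p.1 p.2 +
          FunctionSpaces.Torus.convect (b p.1) (Ψ p.1) p.2 + viscAdjVar (𝔹 p.1) (Ψ p.1) p.2⟫_ℝ ∂μ) +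
        ∫ x, ⟪w₀ x, Ψ 0 x⟫_ℝ = 0 := fun Ψ hΨ hΨdiv =>
    undamped_weak_of_dampedVar 𝔹 hUweak hΨ hΨdiv
  -- the `L^∞_t L²_x` bound (truncated energy argument with the weak gradient)
  have hbound := ae_integral_norm_sq_le_of_weakVar h𝔸 hlo0 h𝔹s h𝔹c h𝔹d hδ0 hδ hw2 hw2s hdivw
    (hGw.mono fun t ht c => (ht c).2) hG2 hbm hM hbM hbdiv hweak hw₀ hdiv₀
  set K : ℝ := (∫ x, ‖w₀ x‖ ^ 2) +
    2 * (2 * (Fintype.card d * M) ^ 2 / lo) * ∫ p, ‖uncurry w p‖ ^ 2 ∂μ +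
    2 * (((Fintype.card d : ℝ) ^ 2 * δ) ^ 2 / (2 * lo)) * ∑ c, ∫ p, ‖uncurry (G · c) p‖ ^ 2 ∂μ with hK
  refine ⟨w, G,
    { aestronglyMeasurable := FunctionSpaces.Torus.aestronglyMeasurable_stLift_of_uncurry hwm
      aestronglyMeasurable_carrier := hb.aestronglyMeasurable
      ae_lintegral_sq_le := ?_
      lintegral_carrier_lt_top := ?_
      lintegral_mul_lt_top := ?_
      ae_isWeaklyDivFree_carrier := hbdiv
      ae_isWeaklyDivFree := hdivw
      weak_eq := ?_ }, hw2, hG2, ?_, hbound⟩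
  · -- `w ∈ L^∞(0,T; L²)`
    refine ⟨K.toNNReal, ?_⟩
    filter_upwards [hbound, hw2s] with t ht hm2
    have e : ∫⁻ x, ‖w t x‖ₑ ^ 2 = ENNReal.ofReal (∫ x, ‖w t x‖ ^ 2) := by
      rw [ofReal_integral_eq_lintegral_ofReal (hm2.integrable_norm_pow two_ne_zero)
        (ae_of_all _ fun x => by positivity)]
      refine lintegral_congr_ae (ae_of_all _ fun x => ?_)
      dsimp only
      rw [ENNReal.ofReal_pow (norm_nonneg _), ofReal_norm]
    rw [e]
    exact ENNReal.ofReal_le_ofReal ht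
  · -- `b ∈ L¹(0,T; L²)`
    calc ∫⁻ t in Ioo 0 T, (∫⁻ x, ‖b t x‖ₑ ^ 2) ^ (1 / 2 : ℝ)
        ≤ ∫⁻ _ in Ioo 0 T, ENNReal.ofReal M := by
          refine lintegral_mono_ae ?_
          filter_upwards [hbMt] with t ht
          calc (∫⁻ x, ‖b t x‖ₑ ^ 2) ^ (1 / 2 : ℝ)
              ≤ (∫⁻ _ : UnitAddTorus d, ENNReal.ofReal M ^ 2) ^ (1 / 2 : ℝ) := by
                refine ENNReal.rpow_le_rpow (lintegral_mono_ae ?_) (by norm_num)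
                filter_upwards [ht] with x hx
                gcongr
                rw [← ofReal_norm]
                exact ENNReal.ofReal_le_ofReal hx
            _ = ENNReal.ofReal M := by
                rw [lintegral_const, measure_univ, mul_one,
                  show (1 / 2 : ℝ) = ((2 : ℕ) : ℝ)⁻¹ by norm_num, ENNReal.pow_rpow_inv_natCast two_ne_zero]
      _ < ⊤ := by
          rw [lintegral_const, Measure.restrict_apply_univ]
          exact ENNReal.mul_lt_top ENNReal.ofReal_lt_top measure_Ioo_lt_top
  · -- `|b| |w| ∈ L¹((0,T) × T^d)`
    have h2 : ∫⁻ p, ‖uncurry w p‖ₑ ∂μ = ∫⁻ t in Ioo 0 T, ∫⁻ x, ‖w t x‖ₑ :=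
      lintegral_prod _ hwm.enorm
    calc ∫⁻ t in Ioo 0 T, ∫⁻ x, ‖b t x‖ₑ * ‖w t x‖ₑ
        ≤ ∫⁻ t in Ioo 0 T, ∫⁻ x, ENNReal.ofReal M * ‖w t x‖ₑ := by
          refine lintegral_mono_ae ?_
          filter_upwards [hbMt] with t ht
          refine lintegral_mono_ae ?_
          filter_upwards [ht] with x hx
          gcongr
          rw [← ofReal_norm]
          exact ENNReal.ofReal_le_ofReal hx
      _ = ENNReal.ofReal M * ∫⁻ p, ‖uncurry w p‖ₑ ∂μ := by
          rw [h2, ← lintegral_const_mul' _ _ ENNReal.ofReal_ne_top]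
          refine lintegral_congr_ae (ae_of_all _ fun t => ?_)
          dsimp only
          rw [lintegral_const_mul' _ _ ENNReal.ofReal_ne_top]
      _ < ⊤ := ENNReal.mul_lt_top ENNReal.ofReal_lt_top hw1.hasFiniteIntegral
  · -- the weak formulation
    intro Ψ hΨ hΨdiv
    have hOp : MemLp (fun p : ℝ × UnitAddTorus d => FunctionSpaces.Torus.timeDeriv Ψ p.1 p.2 +
        FunctionSpaces.Torus.convect (b p.1) (Ψ p.1) p.2 + viscAdjVar (𝔹 p.1) (Ψ p.1) p.2) 2 μ := by
      refine ((memLp_two_dampedOpVar h𝔹s h𝔹c h𝔹d hΨ hbm hbM).add hΨ.memLp_two_uncurry).ae_eq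
        (ae_of_all _ fun p => ?_)
      simp only [Pi.add_apply, Function.uncurry]
      abel
    have hint : Integrable (fun p : ℝ × UnitAddTorus d => ⟪w p.1 p.2, FunctionSpaces.Torus.timeDeriv Ψ p.1 p.2 +
        FunctionSpaces.Torus.convect (b p.1) (Ψ p.1) p.2 + viscAdjVar (𝔹 p.1) (Ψ p.1) p.2⟫_ℝ) μ :=
      integrable_inner_of_memLp_two_V6 hw2 hOp
    have hprod : ∫ t in Ioo 0 T, ∫ x, ⟪w t x, FunctionSpaces.Torus.timeDeriv Ψ t x +
          FunctionSpaces.Torus.convect (b t) (Ψ t) x + viscAdjVar (𝔹 t) (Ψ t) x⟫_ℝ =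
        ∫ p, ⟪w p.1 p.2, FunctionSpaces.Torus.timeDeriv Ψ p.1 p.2 +
          FunctionSpaces.Torus.convect (b p.1) (Ψ p.1) p.2 + viscAdjVar (𝔹 p.1) (Ψ p.1) p.2⟫_ℝ ∂μ :=
      (integral_prod _ hint).symm
    simp only [zero_mul, add_zero]
    rw [hprod]
    exact hweak Ψ hΨ hΨdiv
  · -- the `L²ₜH¹ₓ` regularity
    filter_upwards [hw2s, hGw] with t h1 h2
    exact ⟨h1, h2⟩

/-- **Carrier in `L^∞`: the essential bound exists.** The same statement with the carrier bound read off
`b ∈ L^∞((0,T) × T^d)` (some `M ≥ 0` with `‖b‖ ≤ M` a.e.), for consumers that do not name `M`.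
[cite: LionsMagenes1972, Chap. 3 Thm. 1.1] -/
theorem exists_isWeakVarTensorPassiveVectorOn' {T : ℝ} (hT : 0 < T) {𝔸 : Visc4 d} {lo hi : ℝ}
    (h𝔸 : NearIso 𝔸 lo hi) {𝔹 : ℝ → UnitAddTorus d → Visc4 d}
    (h𝔹s : ∀ t i c j e, FunctionSpaces.Torus.IsSmooth (fun y => 𝔹 t y i c j e))
    (h𝔹c : ∀ i c j e, Continuous (uncurry fun t y => 𝔹 t y i c j e))
    (h𝔹d : ∀ i c j e e', Continuous (uncurry fun t y =>
      FunctionSpaces.Torus.partialDeriv e' (fun y => 𝔹 t y i c j e) y))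
    {δ : ℝ} (hδ0 : 0 ≤ δ) (hδ : ∀ t y i c j e, |𝔹 t y i c j e - 𝔸 i c j e| ≤ δ)
    (hlo : (Fintype.card d : ℝ) ^ 2 * δ < lo)
    {b : ℝ → UnitAddTorus d → EuclideanSpace ℝ d}
    (hb : MemLp (FunctionSpaces.Torus.stLift b) ∞ (volume.restrict (Ioo 0 T ×ˢ univ)))
    (hbdiv : ∀ᵐ t ∂(volume.restrict (Ioo 0 T)), FunctionSpaces.Torus.IsWeaklyDivFree (b t))
    {w₀ : UnitAddTorus d → EuclideanSpace ℝ d} (hw₀ : MemLp w₀ 2 volume)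
    (hdiv₀ : FunctionSpaces.Torus.IsWeaklyDivFree w₀) :
    ∃ (w : ℝ → UnitAddTorus d → EuclideanSpace ℝ d) (G : ℝ → d → UnitAddTorus d → EuclideanSpace ℝ d),
      IsWeakVarTensorPassiveVectorOn 0 T 𝔹 b w₀ w ∧
      MemLp (uncurry w) 2 (((volume : Measure ℝ).restrict (Ioo 0 T)).prod volume) ∧
      (∀ c, MemLp (uncurry (G · c)) 2 (((volume : Measure ℝ).restrict (Ioo 0 T)).prod volume)) ∧
      (∀ᵐ t ∂(volume.restrict (Ioo 0 T)), MemLp (w t) 2 volume ∧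
        ∀ c, MemLp (G t c) 2 volume ∧ FunctionSpaces.Torus.HasWeakPartialDeriv c (w t) (G t c)) := by
  obtain ⟨M, hM, hbM⟩ := ae_norm_le_prod_of_memLp_top_stLift hb
  obtain ⟨w, G, h1, h2, h3, h4, -⟩ := exists_isWeakVarTensorPassiveVectorOn hT h𝔸 h𝔹s h𝔹c h𝔹d hδ0 hδ hlo hb
    hbdiv hM hbM hw₀ hdiv₀
  exact ⟨w, G, h1, h2, h3, h4⟩

end Existence

end Torus

end Literature.Analysis.FluidPDE

end
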